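import Literature.Geometry.Riemannian.GurskyViaclovskyClosednessBootstrapAux
import Literature.Geometry.Riemannian.GurskyViaclovskyBackgroundNaturalityC2
import Literature.Geometry.Riemannian.GurskyViaclovskyChartEquationC2
import HarnessLib

/-!
# Gursky–Viaclovsky: ellipticity along `C²` solutions of the weighted `σ₂` path equation

Support file (everything PROVED; no definition, no named fact) for the Gursky–Viaclovsky
continuity method behind `Literature.Geometry.Riemannian.gurskyViaclovsky_pathClosed_weighted_four`
and its openness companion `gurskyViaclovsky_pathOpen_weighted_four`. The "ellipticity along a
solution" chain of the closedness files — `uniformlyElliptic_along_solution` (Ellipticity file),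
`symbol_uniformlyElliptic_along_solution` (ChartEllipticity), `symbol_euclid_bounds_along_solution`
(ChartSymbolEuclid), `le_fderiv_jetOperator_single` (BootstrapAux) — and the naturality of the
background scalar `backgroundScalar_comap` (BackgroundNaturality) are stated there for SMOOTH
solutions `u`, but every proof uses `u` at order `2` at the point only (the symmetry of the
Hessian `hessian_symm_holds`, the frame expansion
`backgroundPathOperator_eq_framePoly_of_contMDiffAt_two`, the chart dictionary
`gvForm_frame_eq_gvMatrix`, the naturality of the Hessian `hessian_comap_apply`, all already
stated for `C²` functions). The regularity step (Gilbarg–Trudinger, Lemma 17.16: a `C^{2,α}`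
solution of a smooth, uniformly elliptic, fully nonlinear equation is smooth) of the openness half
`gurskyViaclovsky_pathOpen_weighted_four` of the continuity method needs the SAME statements for
solutions which are only `C²` at the point. This file re-proves them under that hypothesis:

* `uniformlyElliptic_along_solution_of_contMDiffAt_two` — "the `C²` estimate implies uniform
  ellipticity", quantitatively, in a `g`-orthonormal frame, for `u` of class `C²` at `x`;
* `symbol_uniformlyElliptic_along_solution_of_contDiffAt_two` — the symbol of the chart operator
  at the jet of a `C²` representative is pinched in the frame norm;
* `symbol_euclid_bounds_along_solution_of_contDiffAt_two` — the same in the Euclidean norm of the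
  covector;
* `le_fderiv_jetOperator_single_of_contDiffAt_two` — Gilbarg–Trudinger's (17.43) for the jet
  function `(y, t, J) ↦ chartOperator G t (W y) y (pOf J) (rOf J) − Q(y)e^{4J₀}` at the coordinate
  `2`-jet of a `C²` solution;
* `backgroundScalar_comap_of_contMDiffAt_two` — naturality of the background scalar under
  equidimensional isometric immersions, for `w` of class `C²` at `Φ y`;
* `fderiv_jetOperator_single_pos_of_contDiffAt_two` — the corollary the regularity step
  consumes: STRICT positivity of the derivative of the jet function in every non-zero rank-one
  top-jet direction `single₂ (η ⊗ η)` at the `2`-jet of a `C²` solution of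
  `backgroundPathOperator g t (−f) y = q e^{4f(y)}`, `q > 0`, `backgroundScalar g (−f) y > 0`,
  `t ≤ 1` — all auxiliary constants (frame, frame length, `‖G y‖`, jet and curvature bounds)
  being chosen at the point.

Nothing here is new mathematics: the statements are those of the source files with
`ContMDiff … ∞ u` weakened to `ContMDiffAt … 2 u x` (resp. the global smoothness of `f` dropped
in favour of the `C²` representative already present), and the proofs are the landed proofs with
that substitution.

## References

* M. J. Gursky, J. A. Viaclovsky, J. Differential Geom. 63 (2003) 131–154, §1 (change1)–(PDE),
  §2 Def. 2 and Prop. 1–2, Prop. 6. [GurskyViaclovsky2003]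
* D. Gilbarg, N. S. Trudinger, *Elliptic Partial Differential Equations of Second Order* (2001),
  §17.4, (17.43), Thm. 17.14, Lemma 17.16. [GilbargTrudinger2001]
* B. O'Neill, *Semi-Riemannian Geometry* (1983), Ch. 3, pp. 90–91 (isometries preserve
  curvature). [ONeill1983]
-/

noncomputable section

set_option maxSynthPendingDepth 3

open scoped Manifold ContDiff Topology
open Set Function Module Finset

namespace Literature.Geometry.Riemannian.GurskyViaclovskyPath

open Literature.Geometry.Lorentzian (PseudoRiemannianMetric)
open Literature.Geometry.Lorentzian.PseudoRiemannianMetric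
open Literature.Geometry.Lorentzian
open Literature.Geometry.Lorentzian.MetricCoord
open Literature.Geometry.Riemannian.GurskyViaclovsky
open Literature.Analysis.Calculus

/-! ### Uniform ellipticity along admissible bounded `C²` solutions -/

section Solution

variable {M : Type*} [TopologicalSpace M] [ChartedSpace (EuclideanSpace ℝ (Fin 4)) M]
  [IsManifold (𝓡 4) ∞ M]
  (g : PseudoRiemannianMetric (𝓡 4) ∞ (EuclideanSpace ℝ (Fin 4)) (TangentSpace (𝓡 4) : M → Type _))
  [g.HasLeviCivita]

/-- **"The `C²` estimate implies uniform ellipticity"** (Gursky–Viaclovsky 2003, proof of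
Prop. 6), quantitatively, at a point and in a `g`-orthonormal frame, for `u` of class `C²` at the
point `x`. If `backgroundPathOperator g t (−u) x = q(x)e^{4u(x)}`, `backgroundScalar g (−u) x > 0`,
`t ≤ 1`, `|t| ≤ T`, `|u x| ≤ C`, `|∇u|²_g(x) ≤ C`, `|∇²u|²_g(x) ≤ C`, `|Ric_g|²(x) ≤ P²`,
`|R_g(x)| ≤ P`, `q x ≥ q₀ > 0`, then Gursky–Viaclovsky's matrix `B = g⁻¹A^t_u` (frame array
`gvMatrix` of the `w = −u` jet) satisfies `λ Σξ² ≤ Σ L^t(B)_{ab} ξ_aξ_b ≤ Λ Σξ²` with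
`λ = q₀e^{−4C}/(8K)`, `Λ = 3K(2−t)`, `K = 4((1+T)P + (3+2T)√C + (5+2T)C) + 1`
(the statement of `uniformlyElliptic_along_solution` with the smoothness hypothesis weakened to
order 2 at the point). [cite: GurskyViaclovsky2003, Prop. 6 (proof) and §2 Prop. 1 (ii)] -/
theorem uniformlyElliptic_along_solution_of_contMDiffAt_two (hg : g.IsRiemannian) {u : M → ℝ}
    {x : M} (hu : ContMDiffAt (𝓡 4) 𝓘(ℝ) 2 u x) {q : M → ℝ} {t q₀ C P T : ℝ} (ht : t ≤ 1)
    (htT : |t| ≤ T) (hq₀ : 0 < q₀) (hC : 0 ≤ C) (hP : 0 ≤ P) (hqx : q₀ ≤ q x)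
    (heq : backgroundPathOperator g t (fun y ↦ -u y) x = q x * Real.exp (-4 * (-u x)))
    (hpos : 0 < backgroundScalar g (fun y ↦ -u y) x)
    (hux : |u x| ≤ C) (hgrad : g.gradSq u x ≤ C) (hhess : g.normSq x (g.hessian u x) ≤ C)
    (hRic : g.normSq x (g.ricci x) ≤ P ^ 2) (hR : |g.scalarCurvature x| ≤ P)
    {e : Fin 4 → TangentSpace (𝓡 4) x} (he : g.IsOrthonormalFrame x e) (ξ : Fin 4 → ℝ) :
    q₀ * Real.exp (-4 * C) / 4 /
          (2 * (4 * ((1 + T) * P + (3 + 2 * T) * Real.sqrt C + (5 + 2 * T) * C) + 1)) *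
        ∑ a, ξ a ^ 2 ≤
      quadForm (ellOp t (gvMatrix t (g.scalarCurvature x) (fun a c ↦ g.ricci x (e a) (e c))
        (fun a c ↦ g.hessian (fun y ↦ -u y) x (e a) (e c))
        (fun a ↦ mvfderiv (𝓡 4) (fun y ↦ -u y) x (e a)))) ξ ∧
    quadForm (ellOp t (gvMatrix t (g.scalarCurvature x) (fun a c ↦ g.ricci x (e a) (e c))
        (fun a c ↦ g.hessian (fun y ↦ -u y) x (e a) (e c))
        (fun a ↦ mvfderiv (𝓡 4) (fun y ↦ -u y) x (e a)))) ξ ≤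
      3 * (4 * ((1 + T) * P + (3 + 2 * T) * Real.sqrt C + (5 + 2 * T) * C) + 1) * (2 - t) *
        ∑ a, ξ a ^ 2 := by
  -- adapted from `uniformlyElliptic_along_solution` (GurskyViaclovskyClosednessEllipticity.lean)
  have hE : finrank ℝ (EuclideanSpace ℝ (Fin 4)) = 4 := finrank_euclideanSpace_fin
  have hn : (2 : ℕ∞ω) ≤ ((⊤ : ℕ∞) : ℕ∞ω) := WithTop.coe_le_coe.mpr le_top
  -- the `w = -u` jet and the curvature data in the frame
  set w : M → ℝ := fun y ↦ -u y with hw_def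
  have hw2 : ContMDiffAt (𝓡 4) 𝓘(ℝ) 2 w x := hu.neg
  set R := g.scalarCurvature x with hR_def
  set Rc : Fin 4 → Fin 4 → ℝ := fun a c ↦ g.ricci x (e a) (e c) with hRc_def
  set Hw : Fin 4 → Fin 4 → ℝ := fun a c ↦ g.hessian w x (e a) (e c) with hHw_def
  set bw : Fin 4 → ℝ := fun a ↦ mvfderiv (𝓡 4) w x (e a) with hbw_def
  set K₀ : ℝ := (1 + T) * P + (3 + 2 * T) * Real.sqrt C + (5 + 2 * T) * C with hK₀
  set K : ℝ := 4 * K₀ + 1 with hK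
  -- symmetries and the trace of `Rc`
  have hRc : ∀ a c, Rc a c = Rc c a := fun a c ↦ (g.ricci_symm_holds hn x).eq (e a) (e c)
  have hH : ∀ a c, Hw a c = Hw c a := fun a c ↦ (g.hessian_symm_holds hw2).eq (e a) (e c)
  have hRsum : ∑ a, Rc a a = R := he.sum_ricci_eq_scalarCurvature g hE
  -- the equation in the frame: `4σ₂(B) − ¼|W|² = q e^{4u}`
  have hframe : framePoly t (g.sigma2WeylSchouten x) R (g.weylNormSq x) Rc Hw bw =
      q x * Real.exp (-4 * (-u x)) := by
    rw [← heq, backgroundPathOperator_eq_framePoly_of_contMDiffAt_two g hw2 t he]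
  have hσ2 : 4 * sigma2 (gvMatrix t R Rc Hw bw) - g.weylNormSq x / 4 =
      q x * Real.exp (-4 * (-u x)) := by
    rw [← framePoly_eq_sigma2_gvMatrix t (g.weylNormSq x) hRc hH hRsum bw, ← hframe,
      sigma2WeylSchouten_eq_sigma2_frame g hg he]
  -- lower bound for `σ₂(B)`
  have hW : 0 ≤ g.weylNormSq x := g.weylNormSq_nonneg x
  have hexp : Real.exp (-4 * C) ≤ Real.exp (-4 * (-u x)) :=
    Real.exp_le_exp.2 (by linarith [(abs_le.1 hux).1])
  have hc : 0 ≤ q₀ * Real.exp (-4 * C) / 4 := by positivity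
  have hcB : q₀ * Real.exp (-4 * C) / 4 ≤ sigma2 (gvMatrix t R Rc Hw bw) := by
    have h1 : q₀ * Real.exp (-4 * C) ≤ q x * Real.exp (-4 * (-u x)) :=
      mul_le_mul hqx hexp (Real.exp_pos _).le (hq₀.le.trans hqx)
    linarith
  -- positivity of `σ₁(B)`
  have h1 : 0 < sigma1 (gvMatrix t R Rc Hw bw) := by
    rw [sigma1_gvMatrix t hRsum Hw bw, ← backgroundScalar_eq_frame g w he]
    exact mul_pos (by linarith) hpos
  -- entry bounds
  have hP' : ∀ a c, |Rc a c| ≤ P := fun a c ↦ by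
    have h := (sq_apply_frame_le_normSq g he (g.ricci x) a c).trans hRic
    have h' := Real.abs_le_sqrt h
    rwa [Real.sqrt_sq hP] at h'
  have hHu : ∀ a c, Hw a c = -g.hessian u x (e a) (e c) := fun a c ↦ by
    change g.hessian (-u) x (e a) (e c) = _
    rw [g.hessian_neg u x]
    rfl
  have hbu : ∀ a, bw a = -mvfderiv (𝓡 4) u x (e a) := fun a ↦ by
    change mvfderiv (𝓡 4) (-u) x (e a) = _
    rw [mvfderiv_neg]
    rfl
  have hHb : ∀ a c, |Hw a c| ≤ Real.sqrt C := fun a c ↦ by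
    rw [hHu, abs_neg]
    exact Real.abs_le_sqrt ((sq_apply_frame_le_normSq g he (g.hessian u x) a c).trans hhess)
  have hbb : ∀ a, |bw a| ≤ Real.sqrt C := fun a ↦ by
    rw [hbu, abs_neg]
    exact Real.abs_le_sqrt ((sq_mvfderiv_frame_le_gradSq g u he a).trans hgrad)
  have hentry : ∀ a c, |gvMatrix t R Rc Hw bw a c| ≤ K₀ := fun a c ↦
    abs_gvMatrix_le hC htT hP' hR hHb hbb a c
  have hK₀0 : 0 ≤ K₀ := (abs_nonneg _).trans (hentry 0 0)
  have hKpos : 0 < K := by rw [hK]; linarith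
  have hBK : frameNormSq (gvMatrix t R Rc Hw bw) ≤ K ^ 2 :=
    (frameNormSq_le_of_entry_le hentry).trans (by rw [hK]; nlinarith)
  -- Gursky–Viaclovsky Prop. 1 (ii), quantitative form
  have key := uniformlyElliptic_ellOp (gvMatrix_symm hRc hH bw) h1 hc hcB hKpos hBK ht ξ
  have hKdef : K = 4 * ((1 + T) * P + (3 + 2 * T) * Real.sqrt C + (5 + 2 * T) * C) + 1 := by
    rw [hK, hK₀]
  rw [hKdef] at key
  exact key

end Solution

/-! ### Naturality of the background scalar, for `C²` functions -/

section Naturality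

variable {M : Type*} [TopologicalSpace M] [ChartedSpace (EuclideanSpace ℝ (Fin 4)) M]
  [IsManifold (𝓡 4) ∞ M]
  {N : Type*} [TopologicalSpace N] [ChartedSpace (EuclideanSpace ℝ (Fin 4)) N]
  [IsManifold (𝓡 4) ∞ N]
  (g : PseudoRiemannianMetric (𝓡 4) ∞ (EuclideanSpace ℝ (Fin 4)) (TangentSpace (𝓡 4) : M → Type _))
  [g.HasLeviCivita]
  {Φ : N → M} (hpb : contMDiff_pullbackBilin (𝓡 4) M (𝓡 4) N ∞)
  (hΦ : ContMDiff (𝓡 4) (𝓡 4) (∞ + 1) Φ)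
  (hΦ' : ∀ y, Function.Injective (mfderiv (𝓡 4) (𝓡 4) Φ y))
  (hdim : finrank ℝ (EuclideanSpace ℝ (Fin 4)) = finrank ℝ (EuclideanSpace ℝ (Fin 4)))
  [(g.comap hpb Φ hΦ hΦ' hdim).HasLeviCivita]

/-- **Naturality of the background scalar, for `w` of class `C²` at `Φ y`**:
`backgroundScalar (Φ^*g) (w ∘ Φ) y = backgroundScalar g w (Φ y)` (`= e^{2w}R_{e^{2w}g}`; scalar
curvature, d'Alembertian and gradient square are natural) for an equidimensional immersion `Φ`
of `4`-manifolds and a Riemannian `g` (the statement of `backgroundScalar_comap` with the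
smoothness hypothesis weakened to order 2 at the point). [cite: ONeill1983, Ch. 3, pp. 90–91] -/
theorem backgroundScalar_comap_of_contMDiffAt_two (hg : g.IsRiemannian) {w : M → ℝ} (y : N)
    (hw : ContMDiffAt (𝓡 4) 𝓘(ℝ) 2 w (Φ y)) :
    backgroundScalar (g.comap hpb Φ hΦ hΦ' hdim) (w ∘ Φ) y = backgroundScalar g w (Φ y) := by
  -- adapted from `backgroundScalar_comap` (GurskyViaclovskyBackgroundNaturality.lean)
  have hE : finrank ℝ (EuclideanSpace ℝ (Fin 4)) = 4 := finrank_euclideanSpace_fin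
  have hn : (2 : ℕ∞ω) ≤ ((⊤ : ℕ∞) : ℕ∞ω) := WithTop.coe_le_coe.mpr le_top
  have hinv := isInvertible_mfderiv_of_injective (Φ := Φ) hdim (hΦ' y)
  obtain ⟨b, hb⟩ := g.exists_basis_isOrthonormalFrame (x := Φ y) (fun v hv ↦ hg _ v hv) hE
  set e : Fin 4 → TangentSpace (𝓡 4) y := fun i ↦ (mfderiv (𝓡 4) (𝓡 4) Φ y).inverse (b i)
    with he_def
  have hde : ∀ i, mfderiv (𝓡 4) (𝓡 4) Φ y (e i) = b i := fun i ↦ hinv.self_apply_inverse (b i)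
  have he : (g.comap hpb Φ hΦ hΦ' hdim).IsOrthonormalFrame y e := by
    rw [g.isOrthonormalFrame_comap_iff hpb hΦ hΦ' hdim]
    simp only [hde]
    exact hb
  have hwd : MDifferentiableAt (𝓡 4) 𝓘(ℝ, ℝ) w (Φ y) := hw.mdifferentiableAt (by simp)
  have hΦd : MDifferentiableAt (𝓡 4) (𝓡 4) Φ y :=
    ((hΦ.of_le le_self_add) y).mdifferentiableAt (by simp)
  have hHess : ∀ a c, (g.comap hpb Φ hΦ hΦ' hdim).hessian (w ∘ Φ) y (e a) (e c) =
      g.hessian w (Φ y) (b a) (b c) := fun a c ↦ by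
    rw [g.hessian_comap_apply hpb hΦ hΦ' hdim hw (e a) (e c), hde, hde]
  have hd : ∀ a, mvfderiv (𝓡 4) (w ∘ Φ) y (e a) = mvfderiv (𝓡 4) w (Φ y) (b a) := fun a ↦ by
    rw [mvfderiv_comp_apply hwd hΦd, hde]
  rw [backgroundScalar_eq_frame _ (w ∘ Φ) he, backgroundScalar_eq_frame g w hb,
    g.scalarCurvature_comap_cn hpb hΦ hΦ' hdim hn y]
  simp only [hHess, hd]

end Naturality

/-! ### The chart symbol along `C²` solutions, on an open subset of `ℝ⁴` -/

section OpensChart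

variable {U : TopologicalSpace.Opens (EuclideanSpace ℝ (Fin 4))}
  (g : PseudoRiemannianMetric 𝓘(ℝ, EuclideanSpace ℝ (Fin 4)) ∞ (EuclideanSpace ℝ (Fin 4))
    (TangentSpace 𝓘(ℝ, EuclideanSpace ℝ (Fin 4)) : U → Type _))
  [g.HasLeviCivita]
  {G : EuclideanSpace ℝ (Fin 4) →
    EuclideanSpace ℝ (Fin 4) →L[ℝ] EuclideanSpace ℝ (Fin 4) →L[ℝ] ℝ}
  (hG : ∀ y : U, g.val y = G y)

include hG in
/-- **Uniform ellipticity of the symbol along `C²` solutions** (GT's (17.43) for the chart form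
of the background equation, in the frame norm). On an open `U ⊆ ℝ⁴` with a Riemannian metric `g`
of components `G`, let `f : U → ℝ` have a representative `F` of class `C²` at `y`, solving at `y`
`backgroundPathOperator g t (−f) y = q(y)e^{4f(y)}` with `backgroundScalar g (−f) y > 0`, `t ≤ 1`,
`|t| ≤ T`, and the bounds `|f y| ≤ C`, `|∇f|²_g(y) ≤ C`, `|∇²f|²_g(y) ≤ C`, `|Ric_g|²(y) ≤ P²`,
`|R_g(y)| ≤ P`, `q y ≥ q₀ > 0`. Then the symbol `S(η) = 4 Σ L^t(M)_{ac} η(b_a)η(b_c)` at the jet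
`(DF(y), D²F(y))` satisfies `4λ Σ_a η(b_a)² ≤ S(η) ≤ 4Λ Σ_a η(b_a)²` with the constants `λ, Λ` of
`uniformlyElliptic_along_solution` (the statement of `symbol_uniformlyElliptic_along_solution`
with the smoothness hypothesis weakened to order 2 at the point).
[cite: GurskyViaclovsky2003, Prop. 6 (proof)] [cite: GilbargTrudinger2001, §17.4, (17.43)] -/
theorem symbol_uniformlyElliptic_along_solution_of_contDiffAt_two (hg : g.IsRiemannian)
    {f : U → ℝ} {F : EuclideanSpace ℝ (Fin 4) → ℝ}
    (hfF : ∀ y : U, f y = F y) {q : U → ℝ} {t q₀ C P T : ℝ} (ht : t ≤ 1) (htT : |t| ≤ T)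
    (hq₀ : 0 < q₀) (hC : 0 ≤ C) (hP : 0 ≤ P) (y : U) (hF : ContDiffAt ℝ 2 F y) (hqy : q₀ ≤ q y)
    (heq : backgroundPathOperator g t (fun z ↦ -f z) y = q y * Real.exp (-4 * (-f y)))
    (hpos : 0 < backgroundScalar g (fun z ↦ -f z) y)
    (hfy : |f y| ≤ C) (hgrad : g.gradSq f y ≤ C) (hhess : g.normSq y (g.hessian f y) ≤ C)
    (hRic : g.normSq y (g.ricci y) ≤ P ^ 2) (hR : |g.scalarCurvature y| ≤ P)
    {b : Basis (Fin 4) ℝ (TangentSpace 𝓘(ℝ, EuclideanSpace ℝ (Fin 4)) y)}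
    (hb : g.IsOrthonormalFrame y b) (η : EuclideanSpace ℝ (Fin 4) →L[ℝ] ℝ) :
    4 * (q₀ * Real.exp (-4 * C) / 4 /
          (2 * (4 * ((1 + T) * P + (3 + 2 * T) * Real.sqrt C + (5 + 2 * T) * C) + 1))) *
        ∑ a, η (b a) ^ 2 ≤
      4 * quadForm (ellOp t fun a c ↦ gvForm G t y (fderiv ℝ F y) (fderiv ℝ (fderiv ℝ F) y)
        (b a) (b c)) (fun a ↦ η (b a)) ∧
    4 * quadForm (ellOp t fun a c ↦ gvForm G t y (fderiv ℝ F y) (fderiv ℝ (fderiv ℝ F) y)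
        (b a) (b c)) (fun a ↦ η (b a)) ≤
      4 * (3 * (4 * ((1 + T) * P + (3 + 2 * T) * Real.sqrt C + (5 + 2 * T) * C) + 1) * (2 - t)) *
        ∑ a, η (b a) ^ 2 := by
  -- adapted from `symbol_uniformlyElliptic_along_solution` (GurskyViaclovskyClosednessChartEllipticity.lean)
  -- `f` is `C²` at `y` (as a map of the manifold `U`), since its representative is
  have hf2 : ContMDiffAt 𝓘(ℝ, EuclideanSpace ℝ (Fin 4)) 𝓘(ℝ) 2 f y := by
    rw [show f = fun z : U ↦ F z from funext hfF]
    exact contMDiffAt_subtype_iff.mpr hF.contMDiffAt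
  have harr : (fun a c ↦ gvForm G t y (fderiv ℝ F y) (fderiv ℝ (fderiv ℝ F) y) (b a) (b c)) =
      gvMatrix t (g.scalarCurvature y) (fun a c ↦ g.ricci y (b a) (b c))
        (fun a c ↦ g.hessian (fun z ↦ -f z) y (b a) (b c))
        (fun a ↦ mvfderiv 𝓘(ℝ, EuclideanSpace ℝ (Fin 4)) (fun z ↦ -f z) y (b a)) := by
    funext a c
    exact gvForm_frame_eq_gvMatrix g hG t hfF y hF hb a c
  have key := uniformlyElliptic_along_solution_of_contMDiffAt_two g hg hf2 ht htT hq₀ hC hP hqy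
    heq hpos hfy hgrad hhess hRic hR hb (fun a ↦ η (b a))
  rw [harr]
  constructor
  · have h := mul_le_mul_of_nonneg_left key.1 (by norm_num : (0 : ℝ) ≤ 4)
    linarith
  · have h := mul_le_mul_of_nonneg_left key.2 (by norm_num : (0 : ℝ) ≤ 4)
    linarith

include hG in
/-- **Two-sided bounds for the chart symbol against the Euclidean norm of the covector, along
`C²` solutions.** With the hypotheses of `symbol_uniformlyElliptic_along_solution_of_contDiffAt_two`
at a point `y` of the chart domain, a `g_y`-orthonormal frame `b` with `‖b_a‖ ≤ κ` and
`‖G(y)‖ ≤ Λ_g`, the `r`-derivative of the chart operator at the jet of `F` in the rank-one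
direction `η ⊗ η` is pinched: `(4λ/(4(Λ_g κ)²))‖η‖² ≤ ∂_r 𝒫[η⊗η] ≤ 4Λ·4κ²‖η‖²` with the
constants `λ, Λ` of `uniformlyElliptic_along_solution` (the statement of
`symbol_euclid_bounds_along_solution` with the smoothness hypothesis weakened to order 2 at the
point). [cite: GurskyViaclovsky2003, Prop. 6 (proof)] [cite: GilbargTrudinger2001, §17.4, (17.43)] -/
theorem symbol_euclid_bounds_along_solution_of_contDiffAt_two (hg : g.IsRiemannian) {f : U → ℝ}
    {F : EuclideanSpace ℝ (Fin 4) → ℝ}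
    (hfF : ∀ y : U, f y = F y) {q : U → ℝ} {t q₀ C P T : ℝ} (ht : t ≤ 1) (htT : |t| ≤ T)
    (hq₀ : 0 < q₀) (hC : 0 ≤ C) (hP : 0 ≤ P) (y : U) (hF : ContDiffAt ℝ 2 F y) (hqy : q₀ ≤ q y)
    (heq : backgroundPathOperator g t (fun z ↦ -f z) y = q y * Real.exp (-4 * (-f y)))
    (hpos : 0 < backgroundScalar g (fun z ↦ -f z) y)
    (hfy : |f y| ≤ C) (hgrad : g.gradSq f y ≤ C) (hhess : g.normSq y (g.hessian f y) ≤ C)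
    (hRic : g.normSq y (g.ricci y) ≤ P ^ 2) (hR : |g.scalarCurvature y| ≤ P)
    {b : Basis (Fin 4) ℝ (TangentSpace 𝓘(ℝ, EuclideanSpace ℝ (Fin 4)) y)}
    (hb : g.IsOrthonormalFrame y b) {κ Λg : ℝ} (hκ0 : 0 ≤ κ)
    (hκ : ∀ a, @norm (EuclideanSpace ℝ (Fin 4)) _ (b a) ≤ κ) (hΛg : ‖G y‖ ≤ Λg) (W : ℝ)
    (η : EuclideanSpace ℝ (Fin 4) →L[ℝ] ℝ) :
    4 * (q₀ * Real.exp (-4 * C) / 4 /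
          (2 * (4 * ((1 + T) * P + (3 + 2 * T) * Real.sqrt C + (5 + 2 * T) * C) + 1))) /
        ((Λg * κ) ^ 2 * 4) * ‖η‖ ^ 2 ≤
      fderiv ℝ (fun r ↦ chartOperator G t W y (fderiv ℝ F y) r) (fderiv ℝ (fderiv ℝ F) y)
        (η.smulRight η) ∧
    fderiv ℝ (fun r ↦ chartOperator G t W y (fderiv ℝ F y) r) (fderiv ℝ (fderiv ℝ F) y)
        (η.smulRight η) ≤
      4 * (3 * (4 * ((1 + T) * P + (3 + 2 * T) * Real.sqrt C + (5 + 2 * T) * C) + 1) * (2 - t)) *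
        (4 * κ ^ 2) * ‖η‖ ^ 2 := by
  -- adapted from `symbol_euclid_bounds_along_solution` (GurskyViaclovskyClosednessChartSymbolEuclid.lean)
  -- the derivative is the symbol, pinched in the frame norm
  have hr : ∀ v w, fderiv ℝ (fderiv ℝ F) y v w = fderiv ℝ (fderiv ℝ F) y w v := fun v w ↦
    (hF.isSymmSndFDerivAt (by simp)).eq v w
  have hval := fderiv_chartOperator_smulRight g hG t W y hb (fderiv ℝ F y) hr η
  obtain ⟨k1, k2⟩ := symbol_uniformlyElliptic_along_solution_of_contDiffAt_two g hG hg hfF ht htT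
    hq₀ hC hP y hF hqy heq hpos hfy hgrad hhess hRic hR hb η
  rw [← hval] at k1 k2
  -- frame norm versus Euclidean norm of `η`
  set e : Fin 4 → EuclideanSpace ℝ (Fin 4) := fun a ↦ b a with he_def
  have hE : finrank ℝ (EuclideanSpace ℝ (Fin 4)) = 4 := finrank_euclideanSpace_fin
  have hon : ∀ a c, G y (e a) (e c) = if a = c then 1 else 0 := by
    intro a c
    have h1 : G y (e a) (e c) = g.val y (b a) (b c) :=
      (congrArg (fun B : EuclideanSpace ℝ (Fin 4) →L[ℝ] EuclideanSpace ℝ (Fin 4) →L[ℝ] ℝ ↦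
        B (b a) (b c)) (hG y)).symm
    rw [h1]
    by_cases hac : a = c
    · subst hac; simp [hb.1 a]
    · simp [hac, hb.2 a c hac]
  have hexp : ∀ v, ∑ a, G y v (e a) • e a = v := sum_smul_frame_eq hE (G y) e hon
  have hκe : ∀ a, ‖e a‖ ≤ κ := hκ
  have hup : ∑ a, η (b a) ^ 2 ≤ 4 * κ ^ 2 * ‖η‖ ^ 2 := by
    have h := sum_sq_frame_le e hκe η
    rw [Fintype.card_fin] at h
    push_cast at h
    exact h
  have hlow : ‖η‖ ^ 2 ≤ (Λg * κ) ^ 2 * 4 * ∑ a, η (b a) ^ 2 := by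
    have h := norm_sq_le_sum_sq_frame (G y) e hexp hΛg hκe hκ0 η
    rw [Fintype.card_fin] at h
    push_cast at h
    exact h
  -- signs of the constants
  have hT : 0 ≤ T := (abs_nonneg t).trans htT
  set K := (1 + T) * P + (3 + 2 * T) * Real.sqrt C + (5 + 2 * T) * C with hK_def
  have hK0 : 0 ≤ K := by rw [hK_def]; positivity
  set lam := q₀ * Real.exp (-4 * C) / 4 / (2 * (4 * K + 1)) with hlam_def
  have hlam0 : 0 ≤ lam := by rw [hlam_def]; positivity
  set Lam := 3 * (4 * K + 1) * (2 - t) with hLam_def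
  have hLam0 : 0 ≤ Lam := by rw [hLam_def]; exact mul_nonneg (by positivity) (by linarith)
  have hS0 : 0 ≤ ∑ a, η (b a) ^ 2 := Finset.sum_nonneg fun a _ ↦ sq_nonneg _
  constructor
  · -- lower bound
    by_cases hD : (Λg * κ) ^ 2 * 4 = 0
    · rw [hD, div_zero, zero_mul]
      exact le_trans (mul_nonneg (mul_nonneg (by norm_num) hlam0) hS0) k1
    · have hD0 : 0 < (Λg * κ) ^ 2 * 4 := lt_of_le_of_ne (by positivity) (Ne.symm hD)
      rw [div_mul_eq_mul_div, div_le_iff₀ hD0]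
      calc 4 * lam * ‖η‖ ^ 2 ≤ 4 * lam * ((Λg * κ) ^ 2 * 4 * ∑ a, η (b a) ^ 2) :=
            mul_le_mul_of_nonneg_left hlow (by positivity)
        _ = 4 * lam * (∑ a, η (b a) ^ 2) * ((Λg * κ) ^ 2 * 4) := by ring
        _ ≤ _ := mul_le_mul_of_nonneg_right k1 hD0.le
  · -- upper bound
    calc _ ≤ 4 * Lam * ∑ a, η (b a) ^ 2 := k2
      _ ≤ 4 * Lam * (4 * κ ^ 2 * ‖η‖ ^ 2) := mul_le_mul_of_nonneg_left hup (by positivity)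
      _ = 4 * Lam * (4 * κ ^ 2) * ‖η‖ ^ 2 := by ring

include hG in
/-- **Uniform ellipticity of the jet function along a `C²` solution** (Gilbarg–Trudinger's
structure condition (17.43) for the chart form of the weighted `σ₂` path equation, in the
Euclidean norm of the covector): with the hypotheses of
`symbol_euclid_bounds_along_solution_of_contDiffAt_two` at `y ∈ U`, the derivative of the jet
function `(y, t, J) ↦ chartOperator G t (W y) y (pOf J) (rOf J) − Q(y) e^{4J₀}` at
`(y, t, cjet₂F(y))` in the direction `(0, 0, single₂ Ω_η)` is at least `λ_E ‖η‖²`,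
`λ_E = 4λ/(4(Λ_gκ)²)` with the constant `λ(q₀, C, P, T)` of `uniformlyElliptic_along_solution`
(the statement of `le_fderiv_jetOperator_single` with the smoothness hypothesis weakened to
order 2 at the point). [cite: GurskyViaclovsky2003, Prop. 6 (proof)] -/
theorem le_fderiv_jetOperator_single_of_contDiffAt_two (hg : g.IsRiemannian)
    (bE : OrthonormalBasis (Fin 4) ℝ (EuclideanSpace ℝ (Fin 4)))
    {W Q : EuclideanSpace ℝ (Fin 4) → ℝ}
    (hW : ContDiffOn ℝ ∞ W (U : Set (EuclideanSpace ℝ (Fin 4))))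
    (hQ : ContDiffOn ℝ ∞ Q (U : Set (EuclideanSpace ℝ (Fin 4)))) {f : U → ℝ}
    {F : EuclideanSpace ℝ (Fin 4) → ℝ}
    (hfF : ∀ y : U, f y = F y) {q : U → ℝ} {t q₀ C P T : ℝ} (ht : t ≤ 1) (htT : |t| ≤ T)
    (hq₀ : 0 < q₀) (hC : 0 ≤ C) (hP : 0 ≤ P) (y : U) (hF : ContDiffAt ℝ 2 F y) (hqy : q₀ ≤ q y)
    (heq : backgroundPathOperator g t (fun z ↦ -f z) y = q y * Real.exp (-4 * (-f y)))
    (hpos : 0 < backgroundScalar g (fun z ↦ -f z) y)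
    (hfy : |f y| ≤ C) (hgrad : g.gradSq f y ≤ C) (hhess : g.normSq y (g.hessian f y) ≤ C)
    (hRic : g.normSq y (g.ricci y) ≤ P ^ 2) (hR : |g.scalarCurvature y| ≤ P)
    {b : Basis (Fin 4) ℝ (TangentSpace 𝓘(ℝ, EuclideanSpace ℝ (Fin 4)) y)}
    (hb : g.IsOrthonormalFrame y b) {κ Λg : ℝ} (hκ0 : 0 ≤ κ)
    (hκ : ∀ a, @norm (EuclideanSpace ℝ (Fin 4)) _ (b a) ≤ κ) (hΛg : ‖G y‖ ≤ Λg)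
    (η : EuclideanSpace ℝ (Fin 4) →L[ℝ] ℝ) :
    4 * (q₀ * Real.exp (-4 * C) / 4 /
          (2 * (4 * ((1 + T) * P + (3 + 2 * T) * Real.sqrt C + (5 + 2 * T) * C) + 1))) /
        ((Λg * κ) ^ 2 * 4) * ‖η‖ ^ 2 ≤
      fderiv ℝ (fun x : EuclideanSpace ℝ (Fin 4) × ℝ × CJet (Fin 4) 2 ↦
          chartOperator G x.2.1 (W x.1) x.1 (pOf bE x.2.2) (rOf bE x.2.2) -
            Q x.1 * Real.exp (4 * x.2.2 0 Fin.elim0))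
        ((y : EuclideanSpace ℝ (Fin 4)), t, cjetOf bE 2 F y)
        ((0 : EuclideanSpace ℝ (Fin 4)), (0 : ℝ),
          Pi.single (Fin.last 2) (fun I : Fin 2 → Fin 4 ↦ η (bE (I 0)) * η (bE (I 1)))) := by
  -- adapted from `le_fderiv_jetOperator_single` (GurskyViaclovskyClosednessBootstrapAux.lean)
  rw [fderiv_jetOperator_single g hG bE hW hQ t y _ η, pOf_cjetOf, rOf_cjetOf bE hF]
  exact (symbol_euclid_bounds_along_solution_of_contDiffAt_two g hG hg hfF ht htT hq₀ hC hP y hF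
    hqy heq hpos hfy hgrad hhess hRic hR hb hκ0 hκ hΛg (W y) η).1

include hG in
/-- **Strict ellipticity of the jet function at the `2`-jet of a `C²` solution.** On an open
`U ⊆ ℝ⁴` with a Riemannian metric `g` of components `G`, let `f : U → ℝ` have a representative
`F` of class `C²` at `y`, solving at `y` the background equation
`backgroundPathOperator g t (−f) y = q e^{4f(y)}` with `q > 0`, `backgroundScalar g (−f) y > 0`
and `t ≤ 1`. Then for every covector `η ≠ 0` the derivative of the jet function
`(y, t, J) ↦ chartOperator G t (W y) y (pOf J) (rOf J) − Q(y) e^{4J₀}` at `(y, t, cjet₂F(y))` in the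
rank-one top-jet direction `(0, 0, single₂ Ω_η)`, `Ω_η(I) = η(e_{I 0})η(e_{I 1})`, is STRICTLY
positive — `le_fderiv_jetOperator_single_of_contDiffAt_two` with the auxiliary constants chosen
at the point: a `g_y`-orthonormal frame `b` (`exists_basis_isOrthonormalFrame`),
`κ = 1 + Σ_a ‖b_a‖`, `Λ_g = ‖G y‖ + 1`, `C = max(|f y|, |∇f|², |∇²f|², 0)`,
`P = √(max(|Ric|², 0)) + |R|`, `T = |t|`, `q₀ = q`; the lower bound `λ_E‖η‖²` is then `> 0`.
This is the pointwise ellipticity the regularity step (Gilbarg–Trudinger, Lemma 17.16) of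
`gurskyViaclovsky_pathOpen_weighted_four` consumes. [cite: GurskyViaclovsky2003, Prop. 6 (proof)] -/
theorem fderiv_jetOperator_single_pos_of_contDiffAt_two (hg : g.IsRiemannian)
    (bE : OrthonormalBasis (Fin 4) ℝ (EuclideanSpace ℝ (Fin 4)))
    {W Q : EuclideanSpace ℝ (Fin 4) → ℝ}
    (hW : ContDiffOn ℝ ∞ W (U : Set (EuclideanSpace ℝ (Fin 4))))
    (hQ : ContDiffOn ℝ ∞ Q (U : Set (EuclideanSpace ℝ (Fin 4)))) {f : U → ℝ}
    {F : EuclideanSpace ℝ (Fin 4) → ℝ} (hfF : ∀ y : U, f y = F y) {t : ℝ} (ht : t ≤ 1)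
    (y : U) (hF : ContDiffAt ℝ 2 F y) {qy : ℝ} (hqy : 0 < qy)
    (heq : backgroundPathOperator g t (fun z ↦ -f z) y = qy * Real.exp (-4 * (-f y)))
    (hpos : 0 < backgroundScalar g (fun z ↦ -f z) y)
    {η : EuclideanSpace ℝ (Fin 4) →L[ℝ] ℝ} (hη : η ≠ 0) :
    0 < fderiv ℝ (fun x : EuclideanSpace ℝ (Fin 4) × ℝ × CJet (Fin 4) 2 ↦
          chartOperator G x.2.1 (W x.1) x.1 (pOf bE x.2.2) (rOf bE x.2.2) -
            Q x.1 * Real.exp (4 * x.2.2 0 Fin.elim0))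
        ((y : EuclideanSpace ℝ (Fin 4)), t, cjetOf bE 2 F y)
        ((0 : EuclideanSpace ℝ (Fin 4)), (0 : ℝ),
          Pi.single (Fin.last 2) (fun I : Fin 2 → Fin 4 ↦ η (bE (I 0)) * η (bE (I 1)))) := by
  classical
  have hE : finrank ℝ (EuclideanSpace ℝ (Fin 4)) = 4 := finrank_euclideanSpace_fin
  -- a `g_y`-orthonormal frame and a bound for its Euclidean lengths
  obtain ⟨b, hb⟩ := g.exists_basis_isOrthonormalFrame (x := y) (fun v hv ↦ hg y v hv) hE
  obtain ⟨κ, hκpos, hκ⟩ : ∃ κ : ℝ, 0 < κ ∧ ∀ a, @norm (EuclideanSpace ℝ (Fin 4)) _ (b a) ≤ κ := by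
    refine ⟨1 + ∑ a, @norm (EuclideanSpace ℝ (Fin 4)) _ (b a), ?_, fun a ↦ ?_⟩
    · have h0 : 0 ≤ ∑ a, @norm (EuclideanSpace ℝ (Fin 4)) _ (b a) :=
        Finset.sum_nonneg fun a _ ↦ norm_nonneg _
      linarith
    · have h : @norm (EuclideanSpace ℝ (Fin 4)) _ (b a) ≤
          ∑ c, @norm (EuclideanSpace ℝ (Fin 4)) _ (b c) :=
        Finset.single_le_sum (f := fun c ↦ @norm (EuclideanSpace ℝ (Fin 4)) _ (b c))
          (fun c _ ↦ norm_nonneg _) (Finset.mem_univ a)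
      linarith
  -- bounds for the components, the jet and the curvature at the point
  obtain ⟨Λg, hΛgpos, hΛg⟩ : ∃ Λg : ℝ, 0 < Λg ∧ ‖G y‖ ≤ Λg :=
    ⟨‖G y‖ + 1, by positivity, by linarith⟩
  obtain ⟨C, hC, hfy, hgrad, hhess⟩ : ∃ C : ℝ, 0 ≤ C ∧ |f y| ≤ C ∧ g.gradSq f y ≤ C ∧
      g.normSq y (g.hessian f y) ≤ C :=
    ⟨max (max |f y| (g.gradSq f y)) (max (g.normSq y (g.hessian f y)) 0),
      le_max_of_le_right (le_max_right _ _), le_max_of_le_left (le_max_left _ _),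
      le_max_of_le_left (le_max_right _ _), le_max_of_le_right (le_max_left _ _)⟩
  obtain ⟨P, hP, hRic, hR⟩ : ∃ P : ℝ, 0 ≤ P ∧ g.normSq y (g.ricci y) ≤ P ^ 2 ∧
      |g.scalarCurvature y| ≤ P := by
    refine ⟨Real.sqrt (max (g.normSq y (g.ricci y)) 0) + |g.scalarCurvature y|, by positivity,
      ?_, le_add_of_nonneg_left (Real.sqrt_nonneg _)⟩
    have h1 : g.normSq y (g.ricci y) ≤ Real.sqrt (max (g.normSq y (g.ricci y)) 0) ^ 2 := by
      rw [Real.sq_sqrt (le_max_right _ _)]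
      exact le_max_left _ _
    have h2 : Real.sqrt (max (g.normSq y (g.ricci y)) 0) ≤
        Real.sqrt (max (g.normSq y (g.ricci y)) 0) + |g.scalarCurvature y| :=
      le_add_of_nonneg_right (abs_nonneg _)
    exact h1.trans (pow_le_pow_left₀ (Real.sqrt_nonneg _) h2 2)
  -- (17.43) at the point, with `T = |t|`, `q₀ = q`
  have key := le_fderiv_jetOperator_single_of_contDiffAt_two g hG hg bE hW hQ hfF
    (q := fun _ : U ↦ qy) (T := |t|) ht le_rfl hqy hC hP y hF le_rfl heq hpos hfy hgrad hhess
    hRic hR hb hκpos.le hκ hΛg η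
  have hc : 0 < 4 * (qy * Real.exp (-4 * C) / 4 /
      (2 * (4 * ((1 + |t|) * P + (3 + 2 * |t|) * Real.sqrt C + (5 + 2 * |t|) * C) + 1))) /
        ((Λg * κ) ^ 2 * 4) := by positivity
  have hη2 : 0 < ‖η‖ ^ 2 := pow_pos (norm_pos_iff.mpr hη) 2
  exact (mul_pos hc hη2).trans_le key

end OpensChart

end Literature.Geometry.Riemannian.GurskyViaclovskyPath

end
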